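import Summits.BirchSwinnertonDyer.Rank1Residual.P2.CongruentNumberSilentEvenFiveSelmerEightAoki
import Summits.BirchSwinnertonDyer.Rank1Residual.P2.CongruentNumberEvenFiveFamilyEnclosureMonskyEven
import Summits.BirchSwinnertonDyer.Rank1Residual.P2.CongruentNumberSilentEvenFiveOddIndexDatum
import Literature.NumberTheory.QuadraticFields.RedeiReichardtFourRank
import HarnessLib

/-!
# Cell `bsd-monsky` (prover-A): the Rédei–Reichardt binder `hR` DISCHARGED in route A's `𝒮⁺` and
# whole-family doors — `BSD(E_{2pq}, 2)` for all `p ≡ 5 (mod 8)`, `q ≡ 3 (mod 4)` from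
# `{hTYZ, hGZK}` + ONE `2`-Selmer input (`h515` | `hMe` | `hAo`) + the `𝒮⁻` input (conjecture | datum | `hSys′`)

HONEST FRAMING (cell `bsd-monsky`, run/shared/lean/pub/bsd-monsky/, README §1: ONE theorem on ONE
explicit infinite family of quadratic twists of the congruent number curve at the prime `2`; not
"BSD for rank ≤ 1", nothing at odd primes, nothing booked until the cross-family referee passes the
written proof). This file asserts NO arithmetic fact and proves nothing new about any curve: every
theorem is the landed theorem of the same name with its binder
`hR : redeiReichardt_fourTwoCard_classGroup` (Rédei–Reichardt 1934 / Li–Ma 2008 Thm. 0.4, the `4`-rank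
formula `r₄ = t − 1 − rank RM(D)`) INSTANTIATED by the tree theorem
`RedeiReichardt.redeiReichardt_fourTwoCard_classGroup_holds`
(`Literature/NumberTheory/QuadraticFields/RedeiReichardtFourRank.lean`, genus theory on ideals). On the
`(p/q) = +1` half the binder fed `odd_genusSum₂'_genusField_two_mul_five_mul` (the genus sum `Σ₂′` odd,
TYZ Thm. 1.2's hypothesis); on `𝒮⁻` nothing ever used it. The names are kept (namespace `RedeiFree`),
so the map «landed door ↦ `hR`-free door» is the identity on names and drops exactly one binder:

* §1 the `𝒮⁺` half `(p/q) = +1` (U⁺ discharged by TYZ): `bsdp_two_congruentNumberCurve_two_mul_five_mul`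
  (`hTYZ hGZK h515`), `…_of_monskyEven` (`hTYZ hGZK hMe`), `…_of_aoki` (`hTYZ hGZK hAo`), and the
  `∀`-forms `forall_bsdp_two_congruentNumberCurve_two_mul_five_mul` / `…_of_monskyEven`.
* §2 the whole even-five two-prime family, both symbol halves: `…_of_conjecture` (`hTYZ hGZK h515`
  + C-P2-1 as a hypothesis), `…_of_conjecture_of_monskyEven` (`hTYZ hGZK hMe` + C-P2-1),
  `…_of_oddIndexHeegnerDatum` (`hTYZ hGZK h515 hmech`), `…_of_oddIndexHeegnerDatum_of_monskyEven`
  (`hTYZ hGZK hMe hmech`), `…_of_genusSystem_of_monskyEven` (`hTYZ hGZK hMe hSys′`) and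
  `…_of_genusSystem_of_aoki` (`hTYZ hGZK hAo hSys′`): `BSD(E_{2pq}, 2)` for ALL primes `p ≡ 5 (mod 8)`,
  `q ≡ 3 (mod 4)` from TYZ §3 data, GZK, one `2`-Selmer input and Tian's system on `𝒮⁻` — no
  Rédei–Reichardt binder anywhere in route A any more (route B's twins: `…GenusParityRR.lean`).

Nothing booked; no mark moved. References: [LiMa2008] Thm. 0.4; [RedeiReichardt1934] Satz;
[TianYuanZhang2017] Thm. 1.2, Thm. 3.5 and §1 (1.1); [Monsky1990MockHeegner] Cor. 5.15 (2′) (p. 66);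
[HeathBrown1994SelmerCongruentII] Appendix (Monsky), typescript p. 41 L20–L36; [Aoki1999] Thm. 2.2 p. 81;
[Tian2014] Thm. 2.8; [Miller2011LMS] Def. 1.1.
-/

noncomputable section

open scoped Classical

open WeierstrassCurve Literature.NumberTheory.EllipticCurves
  Literature.NumberTheory.EllipticCurves.Aoki1999
  Literature.NumberTheory.EllipticCurves.Rank1Residual
  Literature.NumberTheory.EllipticCurves.Rank1Residual.Typed
  Literature.NumberTheory.EllipticCurves.HeathBrown1994
  Literature.NumberTheory.EllipticCurves.HeathBrown1994.Families
  Literature.NumberTheory.EllipticCurves.Monsky1990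
  Literature.NumberTheory.EllipticCurves.TianYuanZhang2017
  Literature.NumberTheory.EllipticCurves.Tian2014
  Literature.NumberTheory.QuadraticFields.RedeiReichardt

set_option autoImplicit false

namespace Summit.BirchSwinnertonDyer.Rank1Residual.P2

open Conjectures

namespace RedeiFree

/-! ## §1 The `𝒮⁺` half `(p/q) = +1`, U⁺ discharged — no Rédei–Reichardt binder -/

/-- **THE EVEN HALF-FAMILY `2·p₅·q`, `q ≡ 3 (mod 4)`, `(p/q) = +1`, U⁺ DISCHARGED — `hR`-free, Monsky 1990
form.** `P2.bsdp_two_congruentNumberCurve_two_mul_five_mul` with the Rédei–Reichardt binder instantiated by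
`redeiReichardt_fourTwoCard_classGroup_holds`. Modulo `hTYZ` (TYZ §3), `hGZK`, `h515` (Monsky 1990 Cor. 5.15).
[cite: TianYuanZhang2017, Thm. 1.2, Thm. 3.5 and §1 (1.1)] [cite: Monsky1990MockHeegner, Cor. 5.15 (2′) (p. 66)]
[cite: LiMa2008, Thm. 0.4] [cite: Miller2011LMS, Def. 1.1 (arXiv:1010.2431 p. 3)] -/
theorem bsdp_two_congruentNumberCurve_two_mul_five_mul
    (hTYZ : tyz_genusPointData) (hGZK : rank_eq_analyticRank_of_analyticRank_le_one)
    (h515 : cor515_rank_eq_one_and_card_selmerGroup_two)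
    {p q : ℕ} (hp : p.Prime) (hq : q.Prime) (hp5 : p % 8 = 5) (hq4 : q % 4 = 3) (hj : jacobiSym p q = 1) :
    haveI := isElliptic_congruentNumberCurve
      (Nat.mul_ne_zero two_ne_zero (Nat.mul_ne_zero hp.ne_zero hq.ne_zero))
    (congruentNumberCurve (2 * (p * q))).analyticRank = 1 ∧ BSDp (congruentNumberCurve (2 * (p * q))) 2 :=
  P2.bsdp_two_congruentNumberCurve_two_mul_five_mul hTYZ hGZK
    redeiReichardt_fourTwoCard_classGroup_holds h515 hp hq hp5 hq4 hj

/-- **The `𝒮⁺` half — `hR`-free, Monsky 1994 form.** `P2.bsdp_two_congruentNumberCurve_two_mul_five_mul_of_monskyEven`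
with `hR` instantiated. Modulo `hTYZ`, `hGZK`, `hMe` (Heath-Brown 1994 appendix, even case printed as a sketch).
[cite: TianYuanZhang2017, Thm. 1.2, Thm. 3.5 and §1 (1.1)] [cite: HeathBrown1994SelmerCongruentII, Appendix (Monsky), typescript p. 41 L20–L36]
[cite: LiMa2008, Thm. 0.4] [cite: Miller2011LMS, Def. 1.1 (arXiv:1010.2431 p. 3)] -/
theorem bsdp_two_congruentNumberCurve_two_mul_five_mul_of_monskyEven
    (hTYZ : tyz_genusPointData) (hGZK : rank_eq_analyticRank_of_analyticRank_le_one)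
    (hMe : monsky_card_selmerGroup_two_even)
    {p q : ℕ} (hp : p.Prime) (hq : q.Prime) (hp5 : p % 8 = 5) (hq4 : q % 4 = 3) (hj : jacobiSym p q = 1) :
    haveI := isElliptic_congruentNumberCurve
      (Nat.mul_ne_zero two_ne_zero (Nat.mul_ne_zero hp.ne_zero hq.ne_zero))
    (congruentNumberCurve (2 * (p * q))).analyticRank = 1 ∧ BSDp (congruentNumberCurve (2 * (p * q))) 2 :=
  P2.bsdp_two_congruentNumberCurve_two_mul_five_mul_of_monskyEven hTYZ hGZK
    redeiReichardt_fourTwoCard_classGroup_holds hMe hp hq hp5 hq4 hj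

/-- **The `𝒮⁺` half — `hR`-free, Aoki 1999 form.** `P2.bsdp_two_congruentNumberCurve_two_mul_five_mul_of_aoki`
with `hR` instantiated. Modulo `hTYZ`, `hGZK`, `hAo` (Aoki 1999 Thm. 2.2, refereed, complete proof in print).
[cite: TianYuanZhang2017, Thm. 1.2, Thm. 3.5 and §1 (1.1)] [cite: Aoki1999, Thm. 2.2 p. 81]
[cite: LiMa2008, Thm. 0.4] [cite: Miller2011LMS, Def. 1.1 (arXiv:1010.2431 p. 3)] -/
theorem bsdp_two_congruentNumberCurve_two_mul_five_mul_of_aoki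
    (hTYZ : tyz_genusPointData) (hGZK : rank_eq_analyticRank_of_analyticRank_le_one)
    (hAo : thm22_card_selmerGroup_two)
    {p q : ℕ} (hp : p.Prime) (hq : q.Prime) (hp5 : p % 8 = 5) (hq4 : q % 4 = 3) (hj : jacobiSym p q = 1) :
    haveI := isElliptic_congruentNumberCurve
      (Nat.mul_ne_zero two_ne_zero (Nat.mul_ne_zero hp.ne_zero hq.ne_zero))
    (congruentNumberCurve (2 * (p * q))).analyticRank = 1 ∧ BSDp (congruentNumberCurve (2 * (p * q))) 2 :=
  P2.bsdp_two_congruentNumberCurve_two_mul_five_mul_of_aoki hTYZ hGZK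
    redeiReichardt_fourTwoCard_classGroup_holds hAo hp hq hp5 hq4 hj

/-- **`BSD(E_{2pq}, 2)` for ALL primes `p ≡ 5 (mod 8)`, `q ≡ 3 (mod 4)` with `(p/q) = +1`** — `hR`-free, modulo
`hTYZ`, `hGZK`, `h515`. [cite: TianYuanZhang2017, Thm. 1.2, Thm. 3.5 and §1 (1.1)]
[cite: Monsky1990MockHeegner, Cor. 5.15 (2′) (p. 66)] [cite: LiMa2008, Thm. 0.4] [cite: Miller2011LMS, Def. 1.1 (arXiv:1010.2431 p. 3)] -/
theorem forall_bsdp_two_congruentNumberCurve_two_mul_five_mul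
    (hTYZ : tyz_genusPointData) (hGZK : rank_eq_analyticRank_of_analyticRank_le_one)
    (h515 : cor515_rank_eq_one_and_card_selmerGroup_two) :
    ∀ p q : ℕ, p.Prime → q.Prime → p % 8 = 5 → q % 4 = 3 → jacobiSym p q = 1 →
      BSDp (congruentNumberCurve (2 * (p * q))) 2 :=
  P2.forall_bsdp_two_congruentNumberCurve_two_mul_five_mul hTYZ hGZK
    redeiReichardt_fourTwoCard_classGroup_holds h515

/-- **`BSD(E_{2pq}, 2)` for ALL primes `p ≡ 5 (mod 8)`, `q ≡ 3 (mod 4)` with `(p/q) = +1`** — `hR`-free, modulo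
`hTYZ`, `hGZK`, `hMe`. [cite: TianYuanZhang2017, Thm. 1.2, Thm. 3.5 and §1 (1.1)]
[cite: HeathBrown1994SelmerCongruentII, Appendix (Monsky), typescript p. 41 L20–L36] [cite: LiMa2008, Thm. 0.4]
[cite: Miller2011LMS, Def. 1.1 (arXiv:1010.2431 p. 3)] -/
theorem forall_bsdp_two_congruentNumberCurve_two_mul_five_mul_of_monskyEven
    (hTYZ : tyz_genusPointData) (hGZK : rank_eq_analyticRank_of_analyticRank_le_one)
    (hMe : monsky_card_selmerGroup_two_even) :
    ∀ p q : ℕ, p.Prime → q.Prime → p % 8 = 5 → q % 4 = 3 → jacobiSym p q = 1 →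
      BSDp (congruentNumberCurve (2 * (p * q))) 2 :=
  P2.forall_bsdp_two_congruentNumberCurve_two_mul_five_mul_of_monskyEven hTYZ hGZK
    redeiReichardt_fourTwoCard_classGroup_holds hMe

/-! ## §2 The whole even-five two-prime family, both symbol halves — no Rédei–Reichardt binder -/

/-- **C-P2-1 is exactly the missing half — `hR`-free, Monsky 1990 form.** Granted `hTYZ`, `hGZK`, `h515` and
the conjecture `CongruentSilentEvenFiveBSDTwo` as a HYPOTHESIS: `BSD(E_{2pq}, 2)` for ALL primes
`p ≡ 5 (mod 8)`, `q ≡ 3 (mod 4)`. `Conjectures.forall_bsdp_two_congruentNumberCurve_two_mul_five_mul_of_conjecture`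
with `hR` instantiated; the conclusion is CONDITIONAL on an OPEN conjecture and asserts nothing.
[cite: TianYuanZhang2017, Thm. 1.2, Thm. 3.5 and §1 (1.1)] [cite: Monsky1990MockHeegner, Cor. 5.15 (2′) (p. 66)]
[cite: LiMa2008, Thm. 0.4] [cite: Miller2011LMS, Def. 1.1 (arXiv:1010.2431 p. 3)] -/
theorem forall_bsdp_two_congruentNumberCurve_two_mul_five_mul_of_conjecture
    (hTYZ : tyz_genusPointData) (hGZK : rank_eq_analyticRank_of_analyticRank_le_one)
    (h515 : cor515_rank_eq_one_and_card_selmerGroup_two) (h : CongruentSilentEvenFiveBSDTwo) :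
    ∀ p q : ℕ, p.Prime → q.Prime → p % 8 = 5 → q % 4 = 3 →
      BSDp (congruentNumberCurve (2 * (p * q))) 2 :=
  Conjectures.forall_bsdp_two_congruentNumberCurve_two_mul_five_mul_of_conjecture hTYZ hGZK
    redeiReichardt_fourTwoCard_classGroup_holds h515 h

/-- **C-P2-1 is exactly the missing half — `hR`-free, Monsky 1994 form.** Granted `hTYZ`, `hGZK`, `hMe` and
the conjecture `CongruentSilentEvenFiveBSDTwo` as a HYPOTHESIS: `BSD(E_{2pq}, 2)` for ALL primes
`p ≡ 5 (mod 8)`, `q ≡ 3 (mod 4)`. CONDITIONAL on an OPEN conjecture; asserts nothing.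
[cite: TianYuanZhang2017, Thm. 1.2, Thm. 3.5 and §1 (1.1)] [cite: HeathBrown1994SelmerCongruentII, Appendix (Monsky), typescript p. 41 L20–L36]
[cite: LiMa2008, Thm. 0.4] [cite: Miller2011LMS, Def. 1.1 (arXiv:1010.2431 p. 3)] -/
theorem forall_bsdp_two_congruentNumberCurve_two_mul_five_mul_of_conjecture_of_monskyEven
    (hTYZ : tyz_genusPointData) (hGZK : rank_eq_analyticRank_of_analyticRank_le_one)
    (hMe : monsky_card_selmerGroup_two_even) (h : CongruentSilentEvenFiveBSDTwo) :
    ∀ p q : ℕ, p.Prime → q.Prime → p % 8 = 5 → q % 4 = 3 →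
      BSDp (congruentNumberCurve (2 * (p * q))) 2 :=
  P2.forall_bsdp_two_congruentNumberCurve_two_mul_five_mul_of_conjecture_of_monskyEven hTYZ hGZK
    redeiReichardt_fourTwoCard_classGroup_holds hMe h

/-- **`BSD(E_{2pq}, 2)` on the WHOLE even-five two-prime family from the odd-index Heegner datum on `𝒮⁻`** —
`hR`-free, modulo `hTYZ`, `hGZK`, `h515` and `hmech` (the datum on every member of `𝒮⁻`).
[cite: TianYuanZhang2017, Thm. 1.2, Thm. 3.5 and §1 (1.1)] [cite: Monsky1990MockHeegner, Cor. 5.15 (2′) (p. 66)]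
[cite: LiMa2008, Thm. 0.4] [cite: Miller2011LMS, Def. 1.1 (arXiv:1010.2431 p. 3)] -/
theorem forall_bsdp_two_congruentNumberCurve_two_mul_five_mul_of_oddIndexHeegnerDatum
    (hTYZ : tyz_genusPointData) (hGZK : rank_eq_analyticRank_of_analyticRank_le_one)
    (h515 : cor515_rank_eq_one_and_card_selmerGroup_two)
    (hmech : ∀ p q : ℕ, p.Prime → q.Prime → p % 8 = 5 → q % 4 = 3 → jacobiSym p q = -1 →
      OddIndexHeegnerDatum (2 * (p * q))) :
    ∀ p q : ℕ, p.Prime → q.Prime → p % 8 = 5 → q % 4 = 3 →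
      BSDp (congruentNumberCurve (2 * (p * q))) 2 :=
  P2.forall_bsdp_two_congruentNumberCurve_two_mul_five_mul_of_oddIndexHeegnerDatum hTYZ hGZK
    redeiReichardt_fourTwoCard_classGroup_holds h515 hmech

/-- **`BSD(E_{2pq}, 2)` on the WHOLE even-five two-prime family from the odd-index Heegner datum on `𝒮⁻`** —
`hR`-free, modulo `hTYZ`, `hGZK`, `hMe` and `hmech`; no Monsky 1990 binder.
[cite: TianYuanZhang2017, Thm. 1.2, Thm. 3.5 and §1 (1.1)] [cite: HeathBrown1994SelmerCongruentII, Appendix (Monsky), typescript p. 41 L20–L36]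
[cite: LiMa2008, Thm. 0.4] [cite: Miller2011LMS, Def. 1.1 (arXiv:1010.2431 p. 3)] -/
theorem forall_bsdp_two_congruentNumberCurve_two_mul_five_mul_of_oddIndexHeegnerDatum_of_monskyEven
    (hTYZ : tyz_genusPointData) (hGZK : rank_eq_analyticRank_of_analyticRank_le_one)
    (hMe : monsky_card_selmerGroup_two_even)
    (hmech : ∀ p q : ℕ, p.Prime → q.Prime → p % 8 = 5 → q % 4 = 3 → jacobiSym p q = -1 →
      OddIndexHeegnerDatum (2 * (p * q))) :
    ∀ p q : ℕ, p.Prime → q.Prime → p % 8 = 5 → q % 4 = 3 →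
      BSDp (congruentNumberCurve (2 * (p * q))) 2 :=
  P2.forall_bsdp_two_congruentNumberCurve_two_mul_five_mul_of_oddIndexHeegnerDatum_of_monskyEven hTYZ hGZK
    redeiReichardt_fourTwoCard_classGroup_holds hMe hmech

/-- **`BSD(E_{2pq}, 2)` for ALL primes `p ≡ 5 (mod 8)`, `q ≡ 3 (mod 4)`, from Tian's CM-point system (genus
form) on `𝒮⁻` and Heath-Brown 1994's Selmer formula** — `hR`-free: modulo `hTYZ`, `hGZK`, `hMe`, `hSys′`
(`tian2014_system_sMinus_genus`) only. Conditional; nothing asserted.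
[cite: TianYuanZhang2017, Thm. 1.2, Thm. 3.5 and §1 (1.1)] [cite: Tian2014, Thm. 2.8 (arXiv:1210.8231 p0011 L25–L44)]
[cite: HeathBrown1994SelmerCongruentII, Appendix (Monsky), typescript p. 41 L20–L36] [cite: LiMa2008, Thm. 0.4]
[cite: Miller2011LMS, Def. 1.1 (arXiv:1010.2431 p. 3)] -/
theorem forall_bsdp_two_congruentNumberCurve_two_mul_five_mul_of_genusSystem_of_monskyEven
    (hTYZ : tyz_genusPointData) (hGZK : rank_eq_analyticRank_of_analyticRank_le_one)
    (hMe : monsky_card_selmerGroup_two_even) (hSys' : tian2014_system_sMinus_genus) :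
    ∀ p q : ℕ, p.Prime → q.Prime → p % 8 = 5 → q % 4 = 3 →
      BSDp (congruentNumberCurve (2 * (p * q))) 2 :=
  P2.forall_bsdp_two_congruentNumberCurve_two_mul_five_mul_of_genusSystem_of_monskyEven hTYZ hGZK
    redeiReichardt_fourTwoCard_classGroup_holds hMe hSys'

/-- **`BSD(E_{2pq}, 2)` for ALL primes `p ≡ 5 (mod 8)`, `q ≡ 3 (mod 4)`, from Tian's CM-point system (genus
form) on `𝒮⁻` and Aoki's count** — `hR`-free: modulo `hTYZ`, `hGZK`, `hAo`, `hSys′` only: the whole even-five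
two-prime family with neither a Monsky 1990, nor a Heath-Brown 1994, nor a Rédei–Reichardt binder.
Conditional; nothing asserted.
[cite: TianYuanZhang2017, Thm. 1.2, Thm. 3.5 and §1 (1.1)] [cite: Tian2014, Thm. 2.8 (arXiv:1210.8231 p0011 L25–L44)]
[cite: Aoki1999, Thm. 2.2 p. 81] [cite: LiMa2008, Thm. 0.4] [cite: Miller2011LMS, Def. 1.1 (arXiv:1010.2431 p. 3)] -/
theorem forall_bsdp_two_congruentNumberCurve_two_mul_five_mul_of_genusSystem_of_aoki
    (hTYZ : tyz_genusPointData) (hGZK : rank_eq_analyticRank_of_analyticRank_le_one)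
    (hAo : thm22_card_selmerGroup_two) (hSys' : tian2014_system_sMinus_genus) :
    ∀ p q : ℕ, p.Prime → q.Prime → p % 8 = 5 → q % 4 = 3 →
      BSDp (congruentNumberCurve (2 * (p * q))) 2 :=
  P2.forall_bsdp_two_congruentNumberCurve_two_mul_five_mul_of_genusSystem_of_aoki hTYZ hGZK
    redeiReichardt_fourTwoCard_classGroup_holds hAo hSys'

end RedeiFree

end Summit.BirchSwinnertonDyer.Rank1Residual.P2

end
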